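/-
Copyright (c) 2026 the pub-hodgecm-mathlib formalisation cell (harness21).  Prover seat hodgecm-mathlib-K2Liu-p09 (g2): Track B «K2-LIT», #184♮ = hLiu418,
payer-internal step «the witnesses `r U s₁`» of file #34 `Theorems/K2LiuDoublingZetaGL1.lean` (LEAD F0P6-plan (g10) DEAL K2/STATUS 2026-09-04T02:36:29Z;
DEPMAP v2.5 §10 TABLE B rows `r U s₁` and «the identity»).
-/
import Mathlib.Analysis.Complex.Basic
import Mathlib.Analysis.Calculus.FDeriv.Mul
import Summits.HodgeConjecture.HodgeConjecture.Theorems.K2LiuDoublingZetaGL1Prelim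
import HarnessLib

/-!
# Crux `HLiu418`, Track B road `K2_Liu`, file #34 — the witnesses `r, U, s₁` of s23 from the four analytic inputs (scalar bookkeeping)

Cell `hodgecm-mathlib`, crux item hLiu418 = `stmt-HodgeConjecture-24832`, route of record `HCCMUnconditional`; squad K2 ∕ K2Liu, LEAD F0P6-plan (g10),
prover K2Liu-p09 (g2).  THEOREMS ONLY (no `def`, no instance, no notation, no named-fact hypothesis, no `sorry`, default heartbeats); lane
`--supports stmt-HodgeConjecture-24832 --as helper` (count-neutral).

The last fifteen lines of the #34 payer, once: with `Z s` = the unfolded doubling zeta integral at `s` (★ #13 ∕ `K2LiuDoublingZetaGL1Unfold`),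
`ZS` = the `S`-part `zetaS` (slots `s`-free), `C s = ∏'_{v ∉ S} c_v(s)` (★ #29s), `P u` = the partial `GL₁` product `ζ^{S_L}_L(u)L^{S_L}(u, ψ)` BY VALUE and
`B` = the normalising product `B^S` (★ #30s), the inputs
 (29) `Z s = C s · ZS s` on `s₁ < re s`;  (30ii) `C s = P (s + 1∕2) · B s` on `1 < re s`;  (30i) `B` holomorphic and zero-free on `{0 < re}`;
 (32) `ZS` holomorphic on `{0 < re}`;  (33) `ZS (1∕2) ≠ 0`;  and `1 ≤ s₁`
give s23's witnesses `r := B · ZS`, `U := {0 < re}` (open, convex, `∋ 1∕2`, `⊇ {s₁ < re}` — ★ `K2LiuDoublingZetaGL1Prelim.domain_re_pos`), with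
`r` holomorphic on `U`, `r (1∕2) ≠ 0` and `Z s = r s · P (s + 1∕2)` on `s₁ < re s` (`assemble_witnesses`).

HONEST LABEL: HC_CM is proved only modulo the printed citations (2 remaining named inputs: hLiu418 = stmt-HodgeConjecture-24832,
h413 = stmt-HodgeConjecture-24833) until rung 0 closes; this file is bookkeeping toward socket s23 and closes no item.
-/

set_option autoImplicit false
set_option linter.dupNamespace false

namespace Summit.HodgeConjecture.HodgeConjecture.Cruxes.HLiu418.K2LiuDoublingZetaGL1Assemble

/-- **s23's witnesses `r, U, s₁` from (29)(30i)(30ii)(32)(33).**  See the module docstring; the conclusion is shaped clause-for-clause like the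
`∃ (r) (U) (s₁) …` block of tier-0 `DoublingZetaGL1` (rev. k :380–:385) with `P (s + 1∕2)` in the place of `partialZetaL L ψ S (s + 1∕2)`.
[cite: Liu2021, proof of Lem. D.1 p. 126 L8–13] -/
theorem assemble_witnesses (Z ZS C B : ℂ → ℂ) (P : ℂ → ℂ) (s₁ : ℝ) (hs₁ : 1 ≤ s₁)
    (h29 : ∀ s : ℂ, s₁ < s.re → Z s = C s * ZS s)
    (h30ii : ∀ s : ℂ, 1 < s.re → C s = P (s + 1 / 2) * B s)
    (h30i : DifferentiableOn ℂ B {s : ℂ | 0 < s.re}) (h30i' : ∀ s : ℂ, 0 < s.re → B s ≠ 0)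
    (h32 : DifferentiableOn ℂ ZS {s : ℂ | 0 < s.re}) (h33 : ZS (1 / 2) ≠ 0) :
    ∃ (r : ℂ → ℂ) (U : Set ℂ) (s₁' : ℝ) (_ : IsOpen U) (_ : Convex ℝ U) (_ : (1 / 2 : ℂ) ∈ U) (_ : (1 : ℝ) ≤ s₁')
      (_ : {s | s₁' < s.re} ⊆ U) (_ : DifferentiableOn ℂ r U) (_ : r (1 / 2) ≠ 0),
      ∀ s : ℂ, s₁' < s.re → Z s = r s * P (s + 1 / 2) := by
  obtain ⟨hUo, hUc, hhalf, hsub⟩ := K2LiuDoublingZetaGL1Prelim.domain_re_pos s₁ hs₁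
  refine ⟨fun s => B s * ZS s, {s : ℂ | 0 < s.re}, s₁, hUo, hUc, hhalf, hs₁, hsub, h30i.mul h32, ?_, fun s hs => ?_⟩
  · have hB : B (1 / 2) ≠ 0 := h30i' (1 / 2) (by norm_num)
    exact mul_ne_zero hB h33
  · have h1 : 1 < s.re := lt_of_le_of_lt hs₁ hs
    rw [h29 s hs, h30ii s h1]
    ring

end Summit.HodgeConjecture.HodgeConjecture.Cruxes.HLiu418.K2LiuDoublingZetaGL1Assemble
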